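import Summits.KontsevichZagierPeriods.KontsevichZagierPeriods.Theorems.LinRedNormalFormWheelThreeSpokesCharts

/-!
# `WheelThreeSpokes` (stmt-KontsevichZagierPeriods-3913), line `laplacian-ldl-chart`:
the unipotent descent `4 → 3` (`stub_unipotentDescent`)

After Möbius storage of the logarithm the chain sits on
`Q = {0<u, 0<v, u+v<1, v < w(1−u), w < 1, wu < s(v+wu), s < 1}` (coordinates `q = (u,v,s,w)`,
the unipotent coordinate `w = −ℓ₃₂` of the LDLᵀ chart LAST) with the integrand `1/(v(1−u−v)s)`,
which does not depend on `w`. The `w`-fibre over `(u,v,s)` is the interval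
`(v/(1−u), min(1, sv/(u(1−s))))`, non-empty iff `u < s`; the two regimes of the `min` are
separated by the null wall `s(u+v) = u`. Hence (this file):

* `Q = Q_E ⊔ Q_F ⊔ (Q ∩ {s(u+v) = u})` with `Q_E`, `Q_F` the open bands over
  `BE = {0<u,0<v,u+v<1, u<s, s(u+v)<u}` (fibre `(v/(1−u), sv/(u(1−s)))`) and
  `BF = {0<u,0<v,u+v<1, u<s(u+v), s<1}` (fibre `(v/(1−u), 1)`) — rule (1a), the wall being null;
* each band is the reverse Newton–Leibniz unfolding (rule (3) along the last coordinate, rational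
  primitive `(w − v/(1−u))/(v(1−u−v)s)`; `exists_unfold_step_fun`) of the base representation
  `E = [BE, (s−u)/(u(1−u)(1−s)(1−u−v)s)]`, resp. `F = [BF, 1/((1−u)vs)]` (fibre length times the
  `w`-free integrand);

so `[Q] ≡ [E] + [F]` modulo `KZ.relations`, and the `Q` representation exists as soon as `E` and `F`
do (its absolute integrability is Tonelli on the two bands). All algebra was checked exactly by the
lead (`work/numerics/chain_check.py` of the line).

References: M. Kontsevich, D. Zagier, *Periods* (2001), §1.2 rules (1), (3).
-/

noncomputable section

open Set MeasureTheory MvPolynomial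
open Literature.NumberTheory.Transcendental
open Literature.ModelTheory.ExponentialFields (IsSemialgebraic isSemialgebraic_setOf_eval_lt)

namespace Summit.KontsevichZagierPeriods.LinRedNormalForm.WheelThreeSpokes


namespace UnipotentDescent


/-- `Q` is `ℚ`-semialgebraic (seven strict polynomial inequalities). -/
theorem isSemialgebraic_Q : IsSemialgebraic ℚ {q : Fin 4 → ℝ | 0 < q 0 ∧ 0 < q 1 ∧ q 0 + q 1 < 1 ∧ q 1 < q 3 * (1 - q 0) ∧ q 3 < 1 ∧ q 3 * q 0 < q 2 * (q 1 + q 3 * q 0) ∧ q 2 < 1} := by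
  have h := ((((((isSemialgebraic_setOf_eval_lt (k := ℚ) (R := ℝ) (0 : MvPolynomial (Fin 4) ℚ)
    (X 0)).inter (isSemialgebraic_setOf_eval_lt (k := ℚ) (R := ℝ) (0 : MvPolynomial (Fin 4) ℚ)
    (X 1))).inter (isSemialgebraic_setOf_eval_lt (k := ℚ) (R := ℝ) (X 0 + X 1 :
    MvPolynomial (Fin 4) ℚ) 1)).inter (isSemialgebraic_setOf_eval_lt (k := ℚ) (R := ℝ)
    (X 1 : MvPolynomial (Fin 4) ℚ) (X 3 * (1 - X 0)))).inter (isSemialgebraic_setOf_eval_lt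
    (k := ℚ) (R := ℝ) (X 3 : MvPolynomial (Fin 4) ℚ) 1)).inter (isSemialgebraic_setOf_eval_lt
    (k := ℚ) (R := ℝ) (X 3 * X 0 : MvPolynomial (Fin 4) ℚ) (X 2 * (X 1 + X 3 * X 0)))).inter
    (isSemialgebraic_setOf_eval_lt (k := ℚ) (R := ℝ) (X 2 : MvPolynomial (Fin 4) ℚ) 1)
  have hset : {q : Fin 4 → ℝ | 0 < q 0 ∧ 0 < q 1 ∧ q 0 + q 1 < 1 ∧ q 1 < q 3 * (1 - q 0) ∧ q 3 < 1 ∧ q 3 * q 0 < q 2 * (q 1 + q 3 * q 0) ∧ q 2 < 1} = (((((({x : Fin 4 → ℝ | aeval x (0 : MvPolynomial (Fin 4) ℚ) < aeval x (X 0 : MvPolynomial (Fin 4) ℚ)} ∩ {x : Fin 4 → ℝ | aeval x (0 : MvPolynomial (Fin 4) ℚ) < aeval x (X 1 : MvPolynomial (Fin 4) ℚ)}) ∩ {x : Fin 4 → ℝ | aeval x (X 0 + X 1 : MvPolynomial (Fin 4) ℚ) < aeval x (1 : MvPolynomial (Fin 4) ℚ)}) ∩ {x : Fin 4 → ℝ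 | aeval x (X 1 : MvPolynomial (Fin 4) ℚ) < aeval x (X 3 * (1 - X 0) : MvPolynomial (Fin 4) ℚ)}) ∩ {x : Fin 4 → ℝ | aeval x (X 3 : MvPolynomial (Fin 4) ℚ) < aeval x (1 : MvPolynomial (Fin 4) ℚ)}) ∩ {x : Fin 4 → ℝ | aeval x (X 3 * X 0 : MvPolynomial (Fin 4) ℚ) < aeval x (X 2 * (X 1 + X 3 * X 0) : MvPolynomial (Fin 4) ℚ)}) ∩ {x : Fin 4 → ℝ | aeval x (X 2 : MvPolynomial (Fin 4) ℚ) < aeval x (1 : MvPolynomial (Fin 4) ℚ)}) := by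
    ext q
    simp only [mem_setOf_eq, mem_inter_iff, map_zero, map_one, map_add, map_mul, map_sub, aeval_X]
    tauto
  rw [hset]
  exact h

/-! ### The two bands as reverse Newton–Leibniz unfoldings -/

/-- **The band over `BE`**: `[E] ≡ [Q_E, 1/(v(1−u−v)s)]`, `Q_E = {(u,v,s,w) | (u,v,s) ∈ BE,
v/(1−u) < w < sv/(u(1−s))}` (rule (3) with the rational primitive `(w − v/(1−u))·g`, then the
null opening of the fibres). [cite: KontsevichZagier2001, §1.2 rule (3)] -/
theorem exists_bandE (e : KZ.IntegralRep 3) (hed : e.domain = {e : Fin 3 → ℝ | 0 < e 0 ∧ 0 < e 1 ∧ e 0 + e 1 < 1 ∧ e 0 < e 2 ∧ e 2 * (e 0 + e 1) < e 0})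
    (hei : EqOn e.integrand
      (fun e => (e 2 - e 0) / (e 0 * (1 - e 0) * (1 - e 2) * (1 - e 0 - e 1) * e 2)) e.domain) :
    ∃ U : KZ.IntegralRep 4,
      U.domain = {z | (Fin.init z : Fin 3 → ℝ) ∈ {e : Fin 3 → ℝ | 0 < e 0 ∧ 0 < e 1 ∧ e 0 + e 1 < 1 ∧ e 0 < e 2 ∧ e 2 * (e 0 + e 1) < e 0} ∧ (fun x : Fin 3 → ℝ => x 1 / (1 - x 0)) (Fin.init z : Fin 3 → ℝ) < z (Fin.last 3) ∧
        z (Fin.last 3) < (fun x : Fin 3 → ℝ => x 2 * x 1 / (x 0 * (1 - x 2))) (Fin.init z : Fin 3 → ℝ)} ∧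
      U.integrand = (fun z => (fun x : Fin 3 → ℝ => 1 / (x 1 * (1 - x 0 - x 1) * x 2)) (Fin.init z)) ∧ KZ.of e - KZ.of U ∈ KZ.relations := by
  have hD : IsSemialgebraic ℚ e.domain := e.isSemialgebraic_domain
  have ha : IsSemialgebraicFunOn ℚ e.domain (fun x : Fin 3 → ℝ => x 1 / (1 - x 0)) := by
    refine (isSemialgebraicFunOn_aeval_div_aeval hD (X 1 : MvPolynomial (Fin 3) ℚ) (1 - X 0)
      ?_).congr ?_
    · intro x hx
      rw [hed] at hx
      obtain ⟨h0, h1, h2, -, -⟩ := hx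
      have : 0 < 1 - x 0 := by linarith
      simp only [map_sub, map_one, aeval_X]
      exact this.ne'
    · intro x _; simp
  have hb : IsSemialgebraicFunOn ℚ e.domain (fun x : Fin 3 → ℝ => x 2 * x 1 / (x 0 * (1 - x 2))) := by
    refine (isSemialgebraicFunOn_aeval_div_aeval hD (X 2 * X 1 : MvPolynomial (Fin 3) ℚ)
      (X 0 * (1 - X 2)) ?_).congr ?_
    · intro x hx
      rw [hed] at hx
      obtain ⟨h0, h1, h2, h3, h4⟩ := hx
      have : 0 < 1 - x 2 := by nlinarith
      simp only [map_mul, map_sub, map_one, aeval_X]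
      positivity
    · intro x _; simp
  have hg : IsSemialgebraicFunOn ℚ e.domain (fun x : Fin 3 → ℝ => 1 / (x 1 * (1 - x 0 - x 1) * x 2)) := by
    refine (isSemialgebraicFunOn_aeval_div_aeval hD (1 : MvPolynomial (Fin 3) ℚ)
      (X 1 * (1 - X 0 - X 1) * X 2) ?_).congr ?_
    · intro x hx
      rw [hed] at hx
      obtain ⟨h0, h1, h2, h3, -⟩ := hx
      have : 0 < 1 - x 0 - x 1 := by linarith
      have : 0 < x 2 := by linarith
      simp only [map_mul, map_sub, map_one, aeval_X]
      positivity
    · intro x _; simp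
  have hAB : ∀ x ∈ e.domain, (fun x : Fin 3 → ℝ => x 1 / (1 - x 0)) x < (fun x : Fin 3 → ℝ => x 2 * x 1 / (x 0 * (1 - x 2))) x := by
    intro x hx
    rw [hed] at hx
    obtain ⟨h0, h1, h2, h3, h4⟩ := hx
    have hu : 0 < 1 - x 0 := by linarith
    have hs : 0 < 1 - x 2 := by nlinarith
    show x 1 / (1 - x 0) < x 2 * x 1 / (x 0 * (1 - x 2))
    rw [div_lt_div_iff₀ hu (by positivity)]
    nlinarith [mul_pos h1 (sub_pos.2 h3)]
  have hint : EqOn e.integrand (fun x => ((fun x : Fin 3 → ℝ => x 2 * x 1 / (x 0 * (1 - x 2))) x - (fun x : Fin 3 → ℝ => x 1 / (1 - x 0)) x) * (fun x : Fin 3 → ℝ => 1 / (x 1 * (1 - x 0 - x 1) * x 2)) x) e.domain := by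
    intro x hx
    rw [hei hx]
    rw [hed] at hx
    obtain ⟨h0, h1, h2, h3, h4⟩ := hx
    have hu : (1 - x 0) ≠ 0 := by apply ne_of_gt; linarith
    have hs : (1 - x 2) ≠ 0 := by apply ne_of_gt; nlinarith
    have huv : (1 - x 0 - x 1) ≠ 0 := by apply ne_of_gt; linarith
    have h0' : x 0 ≠ 0 := h0.ne'
    have h1' : x 1 ≠ 0 := h1.ne'
    have h2' : x 2 ≠ 0 := by apply ne_of_gt; linarith
    simp only
    field_simp
    ring
  obtain ⟨U, hUd, hUi, hUrel⟩ := exists_unfold_step_fun e (fun x : Fin 3 → ℝ => x 1 / (1 - x 0)) (fun x : Fin 3 → ℝ => x 2 * x 1 / (x 0 * (1 - x 2))) (fun x : Fin 3 → ℝ => 1 / (x 1 * (1 - x 0 - x 1) * x 2)) ha hb hg hAB hint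
  refine ⟨U, ?_, hUi, hUrel⟩
  rw [hUd, hed]

/-- **The band over `BF`**: `[F] ≡ [Q_F, 1/(v(1−u−v)s)]`, `Q_F = {(u,v,s,w) | (u,v,s) ∈ BF,
v/(1−u) < w < 1}`. [cite: KontsevichZagier2001, §1.2 rule (3)] -/
theorem exists_bandF (f : KZ.IntegralRep 3) (hfd : f.domain = {f : Fin 3 → ℝ | 0 < f 0 ∧ 0 < f 1 ∧ f 0 + f 1 < 1 ∧ f 0 < f 2 * (f 0 + f 1) ∧ f 2 < 1})
    (hfi : EqOn f.integrand (fun f => 1 / ((1 - f 0) * f 1 * f 2)) f.domain) :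
    ∃ U : KZ.IntegralRep 4,
      U.domain = {z | (Fin.init z : Fin 3 → ℝ) ∈ {f : Fin 3 → ℝ | 0 < f 0 ∧ 0 < f 1 ∧ f 0 + f 1 < 1 ∧ f 0 < f 2 * (f 0 + f 1) ∧ f 2 < 1} ∧ (fun x : Fin 3 → ℝ => x 1 / (1 - x 0)) (Fin.init z : Fin 3 → ℝ) < z (Fin.last 3) ∧
        z (Fin.last 3) < (fun _ : Fin 3 → ℝ => (1 : ℝ)) (Fin.init z : Fin 3 → ℝ)} ∧
      U.integrand = (fun z => (fun x : Fin 3 → ℝ => 1 / (x 1 * (1 - x 0 - x 1) * x 2)) (Fin.init z)) ∧ KZ.of f - KZ.of U ∈ KZ.relations := by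
  have hD : IsSemialgebraic ℚ f.domain := f.isSemialgebraic_domain
  have ha : IsSemialgebraicFunOn ℚ f.domain (fun x : Fin 3 → ℝ => x 1 / (1 - x 0)) := by
    refine (isSemialgebraicFunOn_aeval_div_aeval hD (X 1 : MvPolynomial (Fin 3) ℚ) (1 - X 0)
      ?_).congr ?_
    · intro x hx
      rw [hfd] at hx
      obtain ⟨h0, h1, h2, -, -⟩ := hx
      have : 0 < 1 - x 0 := by linarith
      simp only [map_sub, map_one, aeval_X]
      exact this.ne'
    · intro x _; simp
  have hb : IsSemialgebraicFunOn ℚ f.domain (fun _ : Fin 3 → ℝ => (1 : ℝ)) := by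
    refine (isSemialgebraicFunOn_aeval hD (1 : MvPolynomial (Fin 3) ℚ)).congr ?_
    intro x _; simp
  have hg : IsSemialgebraicFunOn ℚ f.domain (fun x : Fin 3 → ℝ => 1 / (x 1 * (1 - x 0 - x 1) * x 2)) := by
    refine (isSemialgebraicFunOn_aeval_div_aeval hD (1 : MvPolynomial (Fin 3) ℚ)
      (X 1 * (1 - X 0 - X 1) * X 2) ?_).congr ?_
    · intro x hx
      rw [hfd] at hx
      obtain ⟨h0, h1, h2, h3, -⟩ := hx
      have : 0 < 1 - x 0 - x 1 := by linarith
      have : 0 < x 2 := by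
        by_contra hcon
        push Not at hcon
        nlinarith
      simp only [map_mul, map_sub, map_one, aeval_X]
      positivity
    · intro x _; simp
  have hAB : ∀ x ∈ f.domain, (fun x : Fin 3 → ℝ => x 1 / (1 - x 0)) x < (fun _ : Fin 3 → ℝ => (1 : ℝ)) x := by
    intro x hx
    rw [hfd] at hx
    obtain ⟨h0, h1, h2, -, -⟩ := hx
    have hu : 0 < 1 - x 0 := by linarith
    show x 1 / (1 - x 0) < 1
    rw [div_lt_one hu]
    linarith
  have hint : EqOn f.integrand (fun x => ((fun _ : Fin 3 → ℝ => (1 : ℝ)) x - (fun x : Fin 3 → ℝ => x 1 / (1 - x 0)) x) * (fun x : Fin 3 → ℝ => 1 / (x 1 * (1 - x 0 - x 1) * x 2)) x) f.domain := by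
    intro x hx
    rw [hfi hx]
    rw [hfd] at hx
    obtain ⟨h0, h1, h2, h3, h4⟩ := hx
    have hu : (1 - x 0) ≠ 0 := by apply ne_of_gt; linarith
    have huv : (1 - x 0 - x 1) ≠ 0 := by apply ne_of_gt; linarith
    have h1' : x 1 ≠ 0 := h1.ne'
    have h2' : x 2 ≠ 0 := by
      apply ne_of_gt
      by_contra hcon
      push Not at hcon
      nlinarith
    simp only
    field_simp
  obtain ⟨U, hUd, hUi, hUrel⟩ := exists_unfold_step_fun f (fun x : Fin 3 → ℝ => x 1 / (1 - x 0)) (fun _ : Fin 3 → ℝ => (1 : ℝ)) (fun x : Fin 3 → ℝ => 1 / (x 1 * (1 - x 0 - x 1) * x 2)) ha hb hg hAB hint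
  refine ⟨U, ?_, hUi, hUrel⟩
  rw [hUd, hfd]

/-! ### The dissection of `Q` -/

/-- Component `0` of `Fin.init`, definitionally. -/
theorem i0 (z : Fin 4 → ℝ) : (Fin.init z : Fin 3 → ℝ) 0 = z 0 := rfl
/-- Component `1` of `Fin.init`, definitionally. -/
theorem i1 (z : Fin 4 → ℝ) : (Fin.init z : Fin 3 → ℝ) 1 = z 1 := rfl
/-- Component `2` of `Fin.init`, definitionally. -/
theorem i2 (z : Fin 4 → ℝ) : (Fin.init z : Fin 3 → ℝ) 2 = z 2 := rfl
/-- The last coordinate of `ℝ⁴`, definitionally. -/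
theorem i3 (z : Fin 4 → ℝ) : z (Fin.last 3) = z 3 := rfl

/-- Points of `Q` have `u < s`. -/
theorem lt_of_mem_Q {z : Fin 4 → ℝ} (hz : z ∈ {q : Fin 4 → ℝ | 0 < q 0 ∧ 0 < q 1 ∧ q 0 + q 1 < 1 ∧ q 1 < q 3 * (1 - q 0) ∧ q 3 < 1 ∧ q 3 * q 0 < q 2 * (q 1 + q 3 * q 0) ∧ q 2 < 1}) : z 0 < z 2 := by
  obtain ⟨h0, h1, h2, h3, h4, h5, h6⟩ := hz
  -- `v < w(1−u)` and `wu(1−s) < sv` give `u(1−s) < s(1−u)`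
  nlinarith [mul_pos h0 h1, mul_pos h1 (sub_pos.2 h6), mul_pos h0 (sub_pos.2 h6)]

/-- The `E`-band lies in `Q`. -/
theorem bandE_subset_Q : {z : Fin 4 → ℝ | (Fin.init z : Fin 3 → ℝ) ∈ {e : Fin 3 → ℝ | 0 < e 0 ∧ 0 < e 1 ∧ e 0 + e 1 < 1 ∧ e 0 < e 2 ∧ e 2 * (e 0 + e 1) < e 0} ∧
      (fun x : Fin 3 → ℝ => x 1 / (1 - x 0)) (Fin.init z : Fin 3 → ℝ) < z (Fin.last 3) ∧ z (Fin.last 3) < (fun x : Fin 3 → ℝ => x 2 * x 1 / (x 0 * (1 - x 2))) (Fin.init z : Fin 3 → ℝ)}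
      ⊆ {q : Fin 4 → ℝ | 0 < q 0 ∧ 0 < q 1 ∧ q 0 + q 1 < 1 ∧ q 1 < q 3 * (1 - q 0) ∧ q 3 < 1 ∧ q 3 * q 0 < q 2 * (q 1 + q 3 * q 0) ∧ q 2 < 1} := by
  intro z hz
  simp only [mem_setOf_eq, i0, i1, i2, i3] at hz
  obtain ⟨⟨h0, h1, h2, h3, h4⟩, ha, hb⟩ := hz
  have hu : 0 < 1 - z 0 := by linarith
  have hs1 : z 2 < 1 := by
    by_contra hcon; push Not at hcon; nlinarith
  have hs : 0 < 1 - z 2 := by linarith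
  rw [div_lt_iff₀ hu] at ha
  rw [lt_div_iff₀ (by positivity)] at hb
  refine ⟨h0, h1, h2, by linarith, ?_, by nlinarith, hs1⟩
  -- w < sv/(u(1-s)) ≤ 1 because s(u+v) < u
  by_contra hcon; push Not at hcon
  nlinarith [mul_pos h0 hs, mul_pos h1 (lt_trans h0 h3)]

/-- The `F`-band lies in `Q`. -/
theorem bandF_subset_Q : {z : Fin 4 → ℝ | (Fin.init z : Fin 3 → ℝ) ∈ {f : Fin 3 → ℝ | 0 < f 0 ∧ 0 < f 1 ∧ f 0 + f 1 < 1 ∧ f 0 < f 2 * (f 0 + f 1) ∧ f 2 < 1} ∧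
      (fun x : Fin 3 → ℝ => x 1 / (1 - x 0)) (Fin.init z : Fin 3 → ℝ) < z (Fin.last 3) ∧ z (Fin.last 3) < (fun _ : Fin 3 → ℝ => (1 : ℝ)) (Fin.init z : Fin 3 → ℝ)}
      ⊆ {q : Fin 4 → ℝ | 0 < q 0 ∧ 0 < q 1 ∧ q 0 + q 1 < 1 ∧ q 1 < q 3 * (1 - q 0) ∧ q 3 < 1 ∧ q 3 * q 0 < q 2 * (q 1 + q 3 * q 0) ∧ q 2 < 1} := by
  intro z hz
  simp only [mem_setOf_eq, i0, i1, i2, i3] at hz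
  obtain ⟨⟨h0, h1, h2, h3, h4⟩, ha, hb⟩ := hz
  have hu : 0 < 1 - z 0 := by linarith
  rw [div_lt_iff₀ hu] at ha
  refine ⟨h0, h1, h2, by linarith, hb, ?_, h4⟩
  -- wu(1-s) < u(1-s) < sv since s(u+v) > u and w < 1
  have hs : 0 < 1 - z 2 := by linarith
  nlinarith [mul_pos h0 hs, mul_pos (mul_pos h0 hs) (sub_pos.2 hb)]

/-- The two bands are disjoint. -/
theorem bandE_inter_bandF :
    {z : Fin 4 → ℝ | (Fin.init z : Fin 3 → ℝ) ∈ {e : Fin 3 → ℝ | 0 < e 0 ∧ 0 < e 1 ∧ e 0 + e 1 < 1 ∧ e 0 < e 2 ∧ e 2 * (e 0 + e 1) < e 0} ∧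
      (fun x : Fin 3 → ℝ => x 1 / (1 - x 0)) (Fin.init z : Fin 3 → ℝ) < z (Fin.last 3) ∧ z (Fin.last 3) < (fun x : Fin 3 → ℝ => x 2 * x 1 / (x 0 * (1 - x 2))) (Fin.init z : Fin 3 → ℝ)} ∩
    {z : Fin 4 → ℝ | (Fin.init z : Fin 3 → ℝ) ∈ {f : Fin 3 → ℝ | 0 < f 0 ∧ 0 < f 1 ∧ f 0 + f 1 < 1 ∧ f 0 < f 2 * (f 0 + f 1) ∧ f 2 < 1} ∧
      (fun x : Fin 3 → ℝ => x 1 / (1 - x 0)) (Fin.init z : Fin 3 → ℝ) < z (Fin.last 3) ∧ z (Fin.last 3) < (fun _ : Fin 3 → ℝ => (1 : ℝ)) (Fin.init z : Fin 3 → ℝ)} = ∅ := by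
  ext z
  simp only [mem_inter_iff, mem_setOf_eq, mem_empty_iff_false, iff_false, i0, i1, i2, i3]
  rintro ⟨⟨⟨-, -, -, -, hE⟩, -, -⟩, ⟨⟨-, -, -, hF, -⟩, -, -⟩⟩
  linarith

/-- Off the two bands, a point of `Q` lies on the wall `s(u+v) = u`. -/
theorem Q_diff_subset_wall : {q : Fin 4 → ℝ | 0 < q 0 ∧ 0 < q 1 ∧ q 0 + q 1 < 1 ∧ q 1 < q 3 * (1 - q 0) ∧ q 3 < 1 ∧ q 3 * q 0 < q 2 * (q 1 + q 3 * q 0) ∧ q 2 < 1} \ ({z : Fin 4 → ℝ | (Fin.init z : Fin 3 → ℝ) ∈ {e : Fin 3 → ℝ | 0 < e 0 ∧ 0 < e 1 ∧ e 0 + e 1 < 1 ∧ e 0 < e 2 ∧ e 2 * (e 0 + e 1) < e 0} ∧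
      (fun x : Fin 3 → ℝ => x 1 / (1 - x 0)) (Fin.init z : Fin 3 → ℝ) < z (Fin.last 3) ∧ z (Fin.last 3) < (fun x : Fin 3 → ℝ => x 2 * x 1 / (x 0 * (1 - x 2))) (Fin.init z : Fin 3 → ℝ)} ∪
    {z : Fin 4 → ℝ | (Fin.init z : Fin 3 → ℝ) ∈ {f : Fin 3 → ℝ | 0 < f 0 ∧ 0 < f 1 ∧ f 0 + f 1 < 1 ∧ f 0 < f 2 * (f 0 + f 1) ∧ f 2 < 1} ∧
      (fun x : Fin 3 → ℝ => x 1 / (1 - x 0)) (Fin.init z : Fin 3 → ℝ) < z (Fin.last 3) ∧ z (Fin.last 3) < (fun _ : Fin 3 → ℝ => (1 : ℝ)) (Fin.init z : Fin 3 → ℝ)}) ⊆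
    {z : Fin 4 → ℝ | aeval z (X 2 * (X 0 + X 1) : MvPolynomial (Fin 4) ℚ) = aeval z (X 0 : MvPolynomial (Fin 4) ℚ)} := by
  intro z hz
  obtain ⟨hzQ, hzn⟩ := hz
  have hus : z 0 < z 2 := lt_of_mem_Q hzQ
  obtain ⟨h0, h1, h2, h3, h4, h5, h6⟩ := hzQ
  simp only [mem_union, mem_setOf_eq, i0, i1, i2, i3, not_or] at hzn
  obtain ⟨hnE, hnF⟩ := hzn
  simp only [mem_setOf_eq, map_mul, map_add, aeval_X]
  have hu : 0 < 1 - z 0 := by linarith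
  have hs : 0 < 1 - z 2 := by linarith
  have ha : z 1 / (1 - z 0) < z 3 := by rw [div_lt_iff₀ hu]; linarith
  rcases lt_trichotomy (z 2 * (z 0 + z 1)) (z 0) with hlt | heq | hgt
  · exfalso
    refine hnE ⟨⟨h0, h1, h2, hus, hlt⟩, ha, ?_⟩
    rw [lt_div_iff₀ (by positivity)]
    nlinarith
  · exact heq
  · exact (hnF ⟨⟨h0, h1, h2, hgt, h6⟩, ha, h4⟩).elim

/-- The wall `s(u+v) = u` is null. -/
theorem volume_wall :
    volume {z : Fin 4 → ℝ | aeval z (X 2 * (X 0 + X 1) : MvPolynomial (Fin 4) ℚ) = aeval z (X 0 : MvPolynomial (Fin 4) ℚ)} = 0 :=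
  ArrangementNormalForm.JanusBands.IntegrateOutLow.volume_setOf_aeval_eq _ _ (fun _ => 1) (by norm_num)

end UnipotentDescent

open UnipotentDescent in
/-- **stub_unipotentDescent**: `[Q] ≡ [E] + [F]` modulo the Kontsevich–Zagier moves — domain
additivity of `Q` along the null wall `s(u+v) = u` into the two open bands over `BE` and `BF`, and
on each band one Newton–Leibniz move (rule 3) along the unipotent coordinate `w`, of which the
integrand `1/(v(1−u−v)s)` is free, with rational primitive — together with the existence of the
`Q` representation from the `E` and `F` ones (Tonelli on the bands).
[cite: KontsevichZagier2001, §1.2 rules (1), (3)] -/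
theorem stub_unipotentDescent :
    (∀ e f : KZ.IntegralRep 3, e.domain = {e : Fin 3 → ℝ | 0 < e 0 ∧ 0 < e 1 ∧ e 0 + e 1 < 1 ∧ e 0 < e 2 ∧ e 2 * (e 0 + e 1) < e 0} →
      Set.EqOn e.integrand (fun e => (e 2 - e 0) / (e 0 * (1 - e 0) * (1 - e 2) * (1 - e 0 - e 1) * e 2)) e.domain →
      f.domain = {f : Fin 3 → ℝ | 0 < f 0 ∧ 0 < f 1 ∧ f 0 + f 1 < 1 ∧ f 0 < f 2 * (f 0 + f 1) ∧ f 2 < 1} →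
      Set.EqOn f.integrand (fun f => 1 / ((1 - f 0) * f 1 * f 2)) f.domain →
      ∃ q : KZ.IntegralRep 4, q.domain = {q : Fin 4 → ℝ | 0 < q 0 ∧ 0 < q 1 ∧ q 0 + q 1 < 1 ∧ q 1 < q 3 * (1 - q 0) ∧ q 3 < 1 ∧ q 3 * q 0 < q 2 * (q 1 + q 3 * q 0) ∧ q 2 < 1} ∧
        q.integrand = fun q => 1 / (q 1 * (1 - q 0 - q 1) * q 2)) ∧
    (∀ (q : KZ.IntegralRep 4) (e f : KZ.IntegralRep 3),
      q.domain = {q : Fin 4 → ℝ | 0 < q 0 ∧ 0 < q 1 ∧ q 0 + q 1 < 1 ∧ q 1 < q 3 * (1 - q 0) ∧ q 3 < 1 ∧ q 3 * q 0 < q 2 * (q 1 + q 3 * q 0) ∧ q 2 < 1} →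
      Set.EqOn q.integrand (fun q => 1 / (q 1 * (1 - q 0 - q 1) * q 2)) q.domain →
      e.domain = {e : Fin 3 → ℝ | 0 < e 0 ∧ 0 < e 1 ∧ e 0 + e 1 < 1 ∧ e 0 < e 2 ∧ e 2 * (e 0 + e 1) < e 0} →
      Set.EqOn e.integrand (fun e => (e 2 - e 0) / (e 0 * (1 - e 0) * (1 - e 2) * (1 - e 0 - e 1) * e 2)) e.domain →
      f.domain = {f : Fin 3 → ℝ | 0 < f 0 ∧ 0 < f 1 ∧ f 0 + f 1 < 1 ∧ f 0 < f 2 * (f 0 + f 1) ∧ f 2 < 1} →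
      Set.EqOn f.integrand (fun f => 1 / ((1 - f 0) * f 1 * f 2)) f.domain →
      KZ.of q - KZ.of e - KZ.of f ∈ KZ.relations) := by
  have hQ : IsSemialgebraic ℚ {q : Fin 4 → ℝ | 0 < q 0 ∧ 0 < q 1 ∧ q 0 + q 1 < 1 ∧ q 1 < q 3 * (1 - q 0) ∧ q 3 < 1 ∧ q 3 * q 0 < q 2 * (q 1 + q 3 * q 0) ∧ q 2 < 1} := isSemialgebraic_Q
  have hQm : MeasurableSet {q : Fin 4 → ℝ | 0 < q 0 ∧ 0 < q 1 ∧ q 0 + q 1 < 1 ∧ q 1 < q 3 * (1 - q 0) ∧ q 3 < 1 ∧ q 3 * q 0 < q 2 * (q 1 + q 3 * q 0) ∧ q 2 < 1} := IsSemialgebraic.measurableSet_holds hQ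
  have hnull : volume ({q : Fin 4 → ℝ | 0 < q 0 ∧ 0 < q 1 ∧ q 0 + q 1 < 1 ∧ q 1 < q 3 * (1 - q 0) ∧ q 3 < 1 ∧ q 3 * q 0 < q 2 * (q 1 + q 3 * q 0) ∧ q 2 < 1} \ ({z : Fin 4 → ℝ | (Fin.init z : Fin 3 → ℝ) ∈ {e : Fin 3 → ℝ | 0 < e 0 ∧ 0 < e 1 ∧ e 0 + e 1 < 1 ∧ e 0 < e 2 ∧ e 2 * (e 0 + e 1) < e 0} ∧
      (fun x : Fin 3 → ℝ => x 1 / (1 - x 0)) (Fin.init z : Fin 3 → ℝ) < z (Fin.last 3) ∧ z (Fin.last 3) < (fun x : Fin 3 → ℝ => x 2 * x 1 / (x 0 * (1 - x 2))) (Fin.init z : Fin 3 → ℝ)} ∪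
      {z : Fin 4 → ℝ | (Fin.init z : Fin 3 → ℝ) ∈ {f : Fin 3 → ℝ | 0 < f 0 ∧ 0 < f 1 ∧ f 0 + f 1 < 1 ∧ f 0 < f 2 * (f 0 + f 1) ∧ f 2 < 1} ∧
      (fun x : Fin 3 → ℝ => x 1 / (1 - x 0)) (Fin.init z : Fin 3 → ℝ) < z (Fin.last 3) ∧ z (Fin.last 3) < (fun _ : Fin 3 → ℝ => (1 : ℝ)) (Fin.init z : Fin 3 → ℝ)})) = 0 :=
    measure_mono_null Q_diff_subset_wall volume_wall
  have hsub : ({z : Fin 4 → ℝ | (Fin.init z : Fin 3 → ℝ) ∈ {e : Fin 3 → ℝ | 0 < e 0 ∧ 0 < e 1 ∧ e 0 + e 1 < 1 ∧ e 0 < e 2 ∧ e 2 * (e 0 + e 1) < e 0} ∧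
      (fun x : Fin 3 → ℝ => x 1 / (1 - x 0)) (Fin.init z : Fin 3 → ℝ) < z (Fin.last 3) ∧ z (Fin.last 3) < (fun x : Fin 3 → ℝ => x 2 * x 1 / (x 0 * (1 - x 2))) (Fin.init z : Fin 3 → ℝ)} ∪
      {z : Fin 4 → ℝ | (Fin.init z : Fin 3 → ℝ) ∈ {f : Fin 3 → ℝ | 0 < f 0 ∧ 0 < f 1 ∧ f 0 + f 1 < 1 ∧ f 0 < f 2 * (f 0 + f 1) ∧ f 2 < 1} ∧
      (fun x : Fin 3 → ℝ => x 1 / (1 - x 0)) (Fin.init z : Fin 3 → ℝ) < z (Fin.last 3) ∧ z (Fin.last 3) < (fun _ : Fin 3 → ℝ => (1 : ℝ)) (Fin.init z : Fin 3 → ℝ)}) ⊆ {q : Fin 4 → ℝ | 0 < q 0 ∧ 0 < q 1 ∧ q 0 + q 1 < 1 ∧ q 1 < q 3 * (1 - q 0) ∧ q 3 < 1 ∧ q 3 * q 0 < q 2 * (q 1 + q 3 * q 0) ∧ q 2 < 1} :=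
    union_subset bandE_subset_Q bandF_subset_Q
  refine ⟨fun e f hed hei hfd hfi => ?_, fun q e f hqd hqi hed hei hfd hfi => ?_⟩
  · -- existence of the `Q` representation
    obtain ⟨UE, hUEd, hUEi, -⟩ := exists_bandE e hed hei
    obtain ⟨UF, hUFd, hUFi, -⟩ := exists_bandF f hfd hfi
    have hgsa : IsSemialgebraicFunOn ℚ {q : Fin 4 → ℝ | 0 < q 0 ∧ 0 < q 1 ∧ q 0 + q 1 < 1 ∧ q 1 < q 3 * (1 - q 0) ∧ q 3 < 1 ∧ q 3 * q 0 < q 2 * (q 1 + q 3 * q 0) ∧ q 2 < 1} (fun q : Fin 4 → ℝ => 1 / (q 1 * (1 - q 0 - q 1) * q 2)) := by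
      refine (isSemialgebraicFunOn_aeval_div_aeval hQ (1 : MvPolynomial (Fin 4) ℚ)
        (X 1 * (1 - X 0 - X 1) * X 2) ?_).congr ?_
      · intro q hq
        have hus := lt_of_mem_Q hq
        obtain ⟨h0, h1, h2, -, -, -, -⟩ := hq
        have : 0 < 1 - q 0 - q 1 := by linarith
        have : 0 < q 2 := by linarith
        simp only [map_mul, map_sub, map_one, aeval_X]
        positivity
      · intro q _; simp
    have hiE : IntegrableOn (fun q : Fin 4 → ℝ => 1 / (q 1 * (1 - q 0 - q 1) * q 2)) UE.domain := by
      refine UE.integrableOn.congr_fun (fun z _ => ?_) (KZ.IntegralRep.measurableSet_domain_holds UE)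
      rw [hUEi]
      rfl
    have hiF : IntegrableOn (fun q : Fin 4 → ℝ => 1 / (q 1 * (1 - q 0 - q 1) * q 2)) UF.domain := by
      refine UF.integrableOn.congr_fun (fun z _ => ?_) (KZ.IntegralRep.measurableSet_domain_holds UF)
      rw [hUFi]
      rfl
    have hiN : IntegrableOn (fun q : Fin 4 → ℝ => 1 / (q 1 * (1 - q 0 - q 1) * q 2))
        ({q : Fin 4 → ℝ | 0 < q 0 ∧ 0 < q 1 ∧ q 0 + q 1 < 1 ∧ q 1 < q 3 * (1 - q 0) ∧ q 3 < 1 ∧ q 3 * q 0 < q 2 * (q 1 + q 3 * q 0) ∧ q 2 < 1} \ (UE.domain ∪ UF.domain)) := by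
      rw [hUEd, hUFd]
      rw [IntegrableOn, Measure.restrict_eq_zero.mpr hnull]
      exact integrable_zero_measure
    have hint : IntegrableOn (fun q : Fin 4 → ℝ => 1 / (q 1 * (1 - q 0 - q 1) * q 2)) {q : Fin 4 → ℝ | 0 < q 0 ∧ 0 < q 1 ∧ q 0 + q 1 < 1 ∧ q 1 < q 3 * (1 - q 0) ∧ q 3 < 1 ∧ q 3 * q 0 < q 2 * (q 1 + q 3 * q 0) ∧ q 2 < 1} := by
      refine ((hiE.union hiF).union hiN).mono_set ?_
      intro z hz
      by_cases h : z ∈ UE.domain ∪ UF.domain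
      · exact Or.inl h
      · exact Or.inr ⟨hz, h⟩
    exact ⟨⟨{q : Fin 4 → ℝ | 0 < q 0 ∧ 0 < q 1 ∧ q 0 + q 1 < 1 ∧ q 1 < q 3 * (1 - q 0) ∧ q 3 < 1 ∧ q 3 * q 0 < q 2 * (q 1 + q 3 * q 0) ∧ q 2 < 1}, _, hQ, hgsa, hint⟩, rfl, rfl⟩
  · -- the move `[q] ≡ [e] + [f]`
    obtain ⟨UE, hUEd, hUEi, hUErel⟩ := exists_bandE e hed hei
    obtain ⟨UF, hUFd, hUFi, hUFrel⟩ := exists_bandF f hfd hfi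
    have hEsa : IsSemialgebraic ℚ UE.domain := UE.isSemialgebraic_domain
    have hFsa : IsSemialgebraic ℚ UF.domain := UF.isSemialgebraic_domain
    have hUsa : IsSemialgebraic ℚ (UE.domain ∪ UF.domain) := hEsa.union hFsa
    have hUsub : UE.domain ∪ UF.domain ⊆ q.domain := by rw [hUEd, hUFd, hqd]; exact hsub
    have hEsub : UE.domain ⊆ q.domain := fun z hz => hUsub (Or.inl hz)
    have hFsub : UF.domain ⊆ q.domain := fun z hz => hUsub (Or.inr hz)
    -- shave the null wall
    have h1 : KZ.of q - KZ.of (q.restrict _ hUsa hUsub) ∈ KZ.relations := by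
      refine q.of_sub_of_restrict_mem_relations hUsa hUsub ?_
      rw [hqd, hUEd, hUFd]
      exact hnull
    -- split the two bands
    have h2 : KZ.of (q.restrict _ hUsa hUsub) - KZ.of (q.restrict _ hEsa hEsub) -
        KZ.of (q.restrict _ hFsa hFsub) ∈ KZ.relations := by
      refine KZ.domainAddRel_subset_relations ⟨4, q.restrict _ hUsa hUsub, q.restrict _ hEsa hEsub,
        q.restrict _ hFsa hFsub, rfl, ?_, fun _ _ => rfl, fun _ _ => rfl, rfl⟩
      rw [KZ.IntegralRep.domain_restrict, KZ.IntegralRep.domain_restrict, hUEd, hUFd,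
        bandE_inter_bandF, measure_empty]
    -- identify the restrictions with the unfoldings
    have h3 : KZ.of (q.restrict _ hEsa hEsub) - KZ.of UE ∈ KZ.relations := by
      refine KZ.of_sub_of_mem_relations_of_eqOn rfl fun z hz => ?_
      rw [KZ.IntegralRep.integrand_restrict, hqi (hEsub hz), hUEi]
      rfl
    have h4 : KZ.of (q.restrict _ hFsa hFsub) - KZ.of UF ∈ KZ.relations := by
      refine KZ.of_sub_of_mem_relations_of_eqOn rfl fun z hz => ?_
      rw [KZ.IntegralRep.integrand_restrict, hqi (hFsub hz), hUFi]
      rfl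
    have : KZ.of q - KZ.of e - KZ.of f = (KZ.of q - KZ.of (q.restrict _ hUsa hUsub)) +
        (KZ.of (q.restrict _ hUsa hUsub) - KZ.of (q.restrict _ hEsa hEsub) -
          KZ.of (q.restrict _ hFsa hFsub)) +
        (KZ.of (q.restrict _ hEsa hEsub) - KZ.of UE) + (KZ.of (q.restrict _ hFsa hFsub) - KZ.of UF) -
        (KZ.of e - KZ.of UE) - (KZ.of f - KZ.of UF) := by abel
    rw [this]
    exact KZ.relations.sub_mem (KZ.relations.sub_mem (KZ.relations.add_mem (KZ.relations.add_mem
      (KZ.relations.add_mem h1 h2) h3) h4) hUErel) hUFrel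

end Summit.KontsevichZagierPeriods.LinRedNormalForm.WheelThreeSpokes
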